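import Summits.NavierStokesRegularity.NavierStokesRegularity.Theorems.ExtremiserTransienceNearExtremalTransienceExtremiserLiouvilleConstantSpeedBarycentreZeroGeneral
import Summits.NavierStokesRegularity.NavierStokesRegularity.Theorems.ExtremiserTransienceNearExtremalTransienceExtremiserLiouvilleConstantSpeedWeakHarmonicGrowthLiouville
import Summits.NavierStokesRegularity.NavierStokesRegularity.Theorems.ExtremiserTransienceNearExtremalTransienceExtremiserLiouvilleConstantSpeedKKTTailTools
import Literature.Analysis.FluidPDE.DivCurlAnnihilator
import Literature.Analysis.FluidPDE.BiotSavartCurlPair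
import Mathlib.MeasureTheory.Integral.MeanInequalities
import HarnessLib

/-!
# Crux `ExtremiserTransience.NearExtremalTransience` (stmt-NavierStokesRegularity-21883), line `extremiser_liouville`,
# stub K1b — BLOW-DOWN LIMITS OF THE RESIDUE ARE ZERO (rigidity of the jet at infinity)

`--supports stmt-NavierStokesRegularity-21883` (helper).  Author: prover seat `ns-el-k1b` (g6).  The CONDITIONAL KILL (N10′) of
record §8: let `(v, μ)` be a K1b residue in a general frame (`‖v‖ ≡ M = ‖c‖ > 0`, multiplier identity, `v − c ∈ L⁶`) whose excess
energy grows at most linearly, `∫_{B_ρ}‖v − c‖² ≤ C ρ` (`ρ ≥ 1`; the jet's finite energy per unit length), and let `Rₙ → ∞`.  If the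
blow-downs `Vₙ(x) = Rₙ (v(Rₙ x) − c)` converge in `L²_loc` to some `U`, then `U = 0` a.e.:

* `∫ ⟪U, ∇θ⟫ = 0` (each `Vₙ` is smooth and solenoidal; pairings pass to the `L²_loc` limit, `tendsto_integral_inner_of_L2loc`);
* `∫ ⟪U, (∂ₐg)c′ − (∂_{c′}g)a⟫ = 0` — the curl-type pairing of `Vₙ` is `Rₙ⁻¹ ∫ ⟪ω, B(Rₙ⁻¹·)⟫` with `B = g·(c′ × a)`
  (`integral_inner_curlPair_blowDown`), which tends to `0` by g6's vorticity law `tendsto_blowDown_vorticity_zero_general`;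
* hence the components of `U` are weakly harmonic (`integral_laplacian_mul_inner_eq_zero_of_curlPair`), `U` inherits the growth
  `∫_{B_L}‖U‖² ≤ C L` (`lintegral_ball_blowDown_sq`, `lintegral_sq_le_of_L2loc`), and the growth Liouville theorem
  `ae_eq_zero_of_weaklyHarmonic_of_growth` (`θ = 1 < 3`) gives `U = 0`.

So every `L²_loc`-cluster point of the blow-down family of a residue jet vanishes: the rigidity half of the "extract a non-trivial
limit object and kill it" programme.  What remains OPEN for K1b is the COMPACTNESS half (a non-zero cluster point, record §8 (α)/(β)).
WHAT THIS IS NOT: K1b is NOT proved; nothing here proves NS regularity. [folklore]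
-/

noncomputable section

open Set Filter Topology MeasureTheory Metric Function
open scoped ENNReal NNReal Topology InnerProductSpace RealInnerProductSpace ContDiff Laplacian
open Literature.Analysis.FluidPDE Literature.Analysis

namespace Summit.NavierStokesRegularity.NavierStokesRegularity.Theorems

-- the problem directory repeats the summit name (`NavierStokesRegularity/NavierStokesRegularity`)
set_option linter.dupNamespace false

namespace ExtremiserLiouville

open DepletionLadder.KStar DepletionLadder.KStar.HalfSpace

variable {v : E3 → E3} {c : E3}

/-! ## Measure-theoretic tools -/

/-- Lebesgue scaling on `ℝ³` for lower integrals: `∫⁻ g(R x) dx = R⁻³ ∫⁻ g`, `R > 0`. [folklore] -/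
theorem lintegral_comp_smul_E3 (g : E3 → ℝ≥0∞) {R : ℝ} (hR : 0 < R) :
    ∫⁻ x, g (R • x) = ENNReal.ofReal ((R ^ 3)⁻¹) * ∫⁻ x, g x := by
  have hme : MeasurableEmbedding (fun x : E3 => R • x) := (Homeomorph.smulOfNeZero R hR.ne').measurableEmbedding
  rw [← hme.lintegral_map g, Measure.map_addHaar_smul volume hR.ne', lintegral_smul_measure, finrank_euclideanSpace,
    Fintype.card_fin, abs_of_nonneg (by positivity), smul_eq_mul]

/-- **`L²(B_L)`-mass of a blow-down**: `∫⁻_{B_L} ‖R (v(Rx) − c)‖ₑ² = R⁻¹ ∫⁻_{B_{RL}} ‖v − c‖ₑ²`, `R > 0`. [folklore] -/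
theorem lintegral_ball_blowDown_sq (v : E3 → E3) (c : E3) {R : ℝ} (hR : 0 < R) (L : ℝ) :
    ∫⁻ x in ball (0 : E3) L, ‖R • (v (R • x) - c)‖ₑ ^ 2 = ENNReal.ofReal R⁻¹ * ∫⁻ x in ball (0 : E3) (R * L), ‖v x - c‖ₑ ^ 2 := by
  have h1 : ∀ x, ‖R • (v (R • x) - c)‖ₑ ^ 2 = ENNReal.ofReal (R ^ 2) * ‖v (R • x) - c‖ₑ ^ 2 := by
    intro x
    rw [enorm_smul, mul_pow, Real.enorm_eq_ofReal hR.le, ENNReal.ofReal_pow hR.le]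
  simp_rw [h1]
  rw [lintegral_const_mul' _ _ ENNReal.ofReal_ne_top, ← lintegral_indicator measurableSet_ball,
    ← lintegral_indicator measurableSet_ball]
  have h2 : (ball (0 : E3) L).indicator (fun x => ‖v (R • x) - c‖ₑ ^ 2) =
      fun x => (ball (0 : E3) (R * L)).indicator (fun y => ‖v y - c‖ₑ ^ 2) (R • x) := by
    funext x
    by_cases hx : x ∈ ball (0 : E3) L
    · have hx' : R • x ∈ ball (0 : E3) (R * L) := by
        rw [mem_ball_zero_iff] at hx ⊢
        rw [norm_smul, Real.norm_eq_abs, abs_of_pos hR]; exact mul_lt_mul_of_pos_left hx hR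
      rw [indicator_of_mem hx, indicator_of_mem hx']
    · have hx' : R • x ∉ ball (0 : E3) (R * L) := by
        rw [mem_ball_zero_iff, not_lt] at hx ⊢
        rw [norm_smul, Real.norm_eq_abs, abs_of_pos hR]; exact mul_le_mul_of_nonneg_left hx hR.le
      rw [indicator_of_notMem hx, indicator_of_notMem hx']
  rw [h2, lintegral_comp_smul_E3 _ hR, ← mul_assoc, ← ENNReal.ofReal_mul (sq_nonneg _)]
  congr 2
  field_simp

/-- Cauchy–Schwarz in `ℝ≥0∞` form: `‖⟪a, b⟫‖ₑ ≤ ‖a‖ₑ ‖b‖ₑ`. [folklore] -/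
theorem enorm_inner_le (a b : E3) : ‖⟪a, b⟫_ℝ‖ₑ ≤ ‖a‖ₑ * ‖b‖ₑ := by
  rw [← ofReal_norm, ← ofReal_norm, ← ofReal_norm, ← ENNReal.ofReal_mul (norm_nonneg _)]
  exact ENNReal.ofReal_le_ofReal (norm_inner_le_norm a b)

/-- **Pairings pass to `L²_loc` limits**: if `∫⁻_{B_L} ‖Fₙ − U‖ₑ² → 0` for every `L > 0`, then
`∫ ⟪Fₙ, Φ⟫ → ∫ ⟪U, Φ⟫` for every continuous compactly supported `Φ` (all pairings integrable). [folklore] -/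
theorem tendsto_integral_inner_of_L2loc {F : ℕ → E3 → E3} {U Φ : E3 → E3}
    (hF : ∀ n, AEStronglyMeasurable (F n) volume) (hU : AEStronglyMeasurable U volume)
    (hΦ : Continuous Φ) (hΦc : HasCompactSupport Φ)
    (hiF : ∀ n, Integrable (fun x => ⟪F n x, Φ x⟫_ℝ)) (hiU : Integrable (fun x => ⟪U x, Φ x⟫_ℝ))
    (hconv : ∀ L : ℝ, 0 < L → Tendsto (fun n => ∫⁻ x in ball (0 : E3) L, ‖F n x - U x‖ₑ ^ 2) atTop (𝓝 0)) :
    Tendsto (fun n => ∫ x, ⟪F n x, Φ x⟫_ℝ) atTop (𝓝 (∫ x, ⟪U x, Φ x⟫_ℝ)) := by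
  obtain ⟨CΦ, hCΦ⟩ := hΦ.bounded_above_of_compact_support hΦc
  obtain ⟨L, hL, hsupp⟩ : ∃ L : ℝ, 0 < L ∧ tsupport Φ ⊆ ball (0 : E3) L := by
    obtain ⟨r, hr⟩ := (hΦc.isCompact.isBounded).subset_ball (0 : E3)
    exact ⟨max r 1, lt_max_of_lt_right one_pos, hr.trans (ball_subset_ball (le_max_left _ _))⟩
  set ε : ℕ → ℝ≥0∞ := fun n => ∫⁻ x in ball (0 : E3) L, ‖F n x - U x‖ₑ ^ 2 with hε
  -- the constant factor `K = (∫⁻_{B_L} CΦ²)^{1/2}`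
  set g : E3 → ℝ≥0∞ := (ball (0 : E3) L).indicator fun _ => ENNReal.ofReal CΦ with hg
  have hgm : Measurable g := measurable_const.indicator measurableSet_ball
  set K : ℝ≥0∞ := (∫⁻ x, g x ^ (2 : ℝ)) ^ (1 / (2 : ℝ)) with hK
  have hKtop : K ≠ ⊤ := by
    refine ENNReal.rpow_ne_top_of_nonneg (by norm_num) (ne_of_lt ?_)
    have h1 : ∫⁻ x, g x ^ (2 : ℝ) = ∫⁻ x in ball (0 : E3) L, ENNReal.ofReal CΦ ^ (2 : ℝ) := by
      rw [← lintegral_indicator measurableSet_ball]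
      refine lintegral_congr fun x => ?_
      by_cases hx : x ∈ ball (0 : E3) L
      · rw [hg, indicator_of_mem hx, indicator_of_mem hx]
      · rw [hg, indicator_of_notMem hx, indicator_of_notMem hx, ENNReal.zero_rpow_of_pos (by norm_num)]
    rw [h1, setLIntegral_const]
    exact ENNReal.mul_lt_top (ENNReal.rpow_lt_top_of_nonneg (by norm_num) ENNReal.ofReal_ne_top) measure_ball_lt_top
  -- the error bound, for `n` with `ε n < ⊤`
  have hbound : ∀ n, ‖(∫ x, ⟪F n x, Φ x⟫_ℝ) - ∫ x, ⟪U x, Φ x⟫_ℝ‖ ≤ (ε n ^ (1 / (2 : ℝ)) * K).toReal ∨ ε n = ⊤ := by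
    intro n
    by_cases htop : ε n = ⊤
    · exact Or.inr htop
    refine Or.inl ?_
    rw [← integral_sub (hiF n) hiU]
    have hpt : ∀ x, ⟪F n x, Φ x⟫_ℝ - ⟪U x, Φ x⟫_ℝ = ⟪F n x - U x, Φ x⟫_ℝ := fun x => by rw [inner_sub_left]
    simp_rw [hpt]
    set f : E3 → ℝ≥0∞ := (ball (0 : E3) L).indicator fun x => ‖F n x - U x‖ₑ with hf
    have hfm : AEMeasurable f volume := (((hF n).sub hU).aemeasurable.enorm).indicator measurableSet_ball
    have hptle : ∀ x, ‖⟪F n x - U x, Φ x⟫_ℝ‖ₑ ≤ (f * g) x := by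
      intro x
      by_cases hx : x ∈ ball (0 : E3) L
      · simp only [Pi.mul_apply, hf, hg, indicator_of_mem hx]
        refine (enorm_inner_le _ _).trans (mul_le_mul' le_rfl ?_)
        rw [← ofReal_norm]; exact ENNReal.ofReal_le_ofReal (hCΦ x)
      · have hΦ0 : Φ x = 0 := image_eq_zero_of_notMem_tsupport fun h => hx (hsupp h)
        rw [hΦ0, inner_zero_right, enorm_zero]; exact bot_le
    have hH := ENNReal.lintegral_mul_le_Lp_mul_Lq volume Real.HolderConjugate.two_two hfm hgm.aemeasurable
    have hf2 : ∫⁻ x, f x ^ (2 : ℝ) = ε n := by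
      rw [hε]; dsimp only
      rw [← lintegral_indicator measurableSet_ball]
      refine lintegral_congr fun x => ?_
      by_cases hx : x ∈ ball (0 : E3) L
      · rw [hf, indicator_of_mem hx, indicator_of_mem hx, ENNReal.rpow_two]
      · rw [hf, indicator_of_notMem hx, indicator_of_notMem hx, ENNReal.zero_rpow_of_pos (by norm_num)]
    rw [hf2] at hH
    refine (norm_integral_le_lintegral_norm _).trans (ENNReal.toReal_mono (ENNReal.mul_ne_top
      (ENNReal.rpow_ne_top_of_nonneg (by norm_num) htop) hKtop) ?_)
    refine (lintegral_mono fun x => ?_).trans hH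
    rw [ofReal_norm]; exact hptle x
  -- the bound tends to `0`
  have hε0 : Tendsto ε atTop (𝓝 0) := hconv L hL
  have hfin : ∀ᶠ n in atTop, ε n < ⊤ := hε0.eventually_lt_const ENNReal.zero_lt_top
  have hb0 : Tendsto (fun n => (ε n ^ (1 / (2 : ℝ)) * K).toReal) atTop (𝓝 0) := by
    have h1 : Tendsto (fun n => ε n ^ (1 / (2 : ℝ))) atTop (𝓝 0) := by
      have h := ((ENNReal.continuous_rpow_const (y := 1 / (2 : ℝ))).tendsto 0).comp hε0
      rwa [ENNReal.zero_rpow_of_pos (by norm_num)] at h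
    have h2 : Tendsto (fun n => ε n ^ (1 / (2 : ℝ)) * K) atTop (𝓝 (0 * K)) := ENNReal.Tendsto.mul_const h1 (Or.inr hKtop)
    rw [zero_mul] at h2
    have h3 := (ENNReal.tendsto_toReal ENNReal.zero_ne_top).comp h2
    rwa [ENNReal.toReal_zero] at h3
  rw [tendsto_iff_norm_sub_tendsto_zero]
  refine squeeze_zero_norm' (hfin.mono fun n hn => ?_) hb0
  rw [norm_norm]
  rcases hbound n with h | h
  · exact h
  · exact absurd h hn.ne

/-- **`L²(B_L)` bounds pass to `L²_loc` limits**: if `∫⁻_{B_L}‖Fₙ‖ₑ² ≤ A` for all `n` and `∫⁻_{B_L}‖Fₙ − U‖ₑ² → 0`, then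
`∫⁻_{B_L}‖U‖ₑ² ≤ A`. [folklore] -/
theorem lintegral_sq_le_of_L2loc {F : ℕ → E3 → E3} {U : E3 → E3}
    (hF : ∀ n, AEStronglyMeasurable (F n) volume) (hU : AEStronglyMeasurable U volume) {L : ℝ} {A : ℝ≥0∞}
    (hA : ∀ n, ∫⁻ x in ball (0 : E3) L, ‖F n x‖ₑ ^ 2 ≤ A)
    (hconv : Tendsto (fun n => ∫⁻ x in ball (0 : E3) L, ‖F n x - U x‖ₑ ^ 2) atTop (𝓝 0)) :
    ∫⁻ x in ball (0 : E3) L, ‖U x‖ₑ ^ 2 ≤ A := by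
  set ν : Measure E3 := volume.restrict (ball (0 : E3) L) with hν
  set ε : ℕ → ℝ≥0∞ := fun n => ∫⁻ x in ball (0 : E3) L, ‖F n x - U x‖ₑ ^ 2 with hε
  -- `‖U‖_{L²(B_L)} ≤ ε_n^{1/2} + A^{1/2}`
  have hn : ∀ n, eLpNorm U 2 ν ≤ ε n ^ (1 / (2 : ℝ)) + A ^ (1 / (2 : ℝ)) := by
    intro n
    have hsplit : U = (U - F n) + F n := by funext x; simp
    have h1 : eLpNorm U 2 ν ≤ eLpNorm (U - F n) 2 ν + eLpNorm (F n) 2 ν := by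
      conv_lhs => rw [hsplit]
      exact eLpNorm_add_le ((hU.sub (hF n)).restrict) (hF n).restrict (by norm_num)
    have h2 : eLpNorm (U - F n) 2 ν ≤ ε n ^ (1 / (2 : ℝ)) := by
      refine eLpNorm_two_le_of_lintegral_sq_le (le_of_eq ?_)
      rw [hε]; dsimp only
      refine lintegral_congr fun x => ?_
      rw [Pi.sub_apply, ← enorm_neg, neg_sub]
    have h3 : eLpNorm (F n) 2 ν ≤ A ^ (1 / (2 : ℝ)) := eLpNorm_two_le_of_lintegral_sq_le (hA n)
    exact h1.trans (add_le_add h2 h3)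
  have hlim : Tendsto (fun n => ε n ^ (1 / (2 : ℝ)) + A ^ (1 / (2 : ℝ))) atTop (𝓝 (A ^ (1 / (2 : ℝ)))) := by
    have h1 : Tendsto (fun n => ε n ^ (1 / (2 : ℝ))) atTop (𝓝 0) := by
      have h := ((ENNReal.continuous_rpow_const (y := 1 / (2 : ℝ))).tendsto 0).comp hconv
      rwa [ENNReal.zero_rpow_of_pos (by norm_num)] at h
    have h2 := h1.add_const (A ^ (1 / (2 : ℝ)))
    rwa [zero_add] at h2
  have hle : eLpNorm U 2 ν ≤ A ^ (1 / (2 : ℝ)) := ge_of_tendsto' hlim hn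
  calc ∫⁻ x in ball (0 : E3) L, ‖U x‖ₑ ^ 2 = eLpNorm U 2 ν ^ 2 := (eLpNorm_two_pow_two _).symm
    _ ≤ (A ^ (1 / (2 : ℝ))) ^ 2 := pow_le_pow_left' hle 2
    _ = A := by rw [← ENNReal.rpow_natCast, ← ENNReal.rpow_mul]; norm_num

/-! ## The blow-down pairings of the residue -/

/-- The derivative of a blow-down: `D[R (v(R·) − c)](x) = (R·R) · Dv(Rx)`. [folklore] -/
theorem fderiv_blowDown (hv : Differentiable ℝ v) (c : E3) (R : ℝ) (x : E3) :
    fderiv ℝ (fun x => R • (v (R • x) - c)) x = (R * R) • fderiv ℝ v (R • x) := by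
  have hlin : Differentiable ℝ fun x : E3 => R • x := differentiable_id.const_smul R
  have hd : DifferentiableAt ℝ (fun x => v (R • x) - c) x := ((hv.comp hlin).sub (differentiable_const c)) x
  rw [fderiv_fun_const_smul hd, fderiv_sub_const]
  have h := fderiv_rescale (Φ := v) hv R⁻¹ x
  simp only [inv_inv] at h
  rw [h, smul_smul]

/-- A blow-down of a `C¹` field is `C¹`. [folklore] -/
theorem contDiff_blowDown {n : WithTop ℕ∞} (hv : ContDiff ℝ n v) (c : E3) (R : ℝ) :
    ContDiff ℝ n fun x => R • (v (R • x) - c) := by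
  have h1 : ContDiff ℝ n fun x : E3 => R • x := contDiff_id.const_smul R
  have h2 : ContDiff ℝ n fun x => v (R • x) - c := (hv.comp h1).sub contDiff_const
  exact h2.const_smul R

/-- **The curl-type pairing of a blow-down is a rescaled vorticity pairing**:
`∫ ⟪R (v(Rx) − c), (∂ₐg) c′ − (∂_{c′}g) a⟫ dx = R⁻¹ ∫ ⟪curl v (y), g(R⁻¹y) (c′ × a)⟫ dy` for `v ∈ C¹`, `g ∈ C_c¹`, `R > 0`.
[folklore] -/
theorem integral_inner_curlPair_blowDown (hv : ContDiff ℝ 1 v) (c : E3) {g : E3 → ℝ} (hg : ContDiff ℝ 1 g)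
    (hgc : HasCompactSupport g) (a c' : E3) {R : ℝ} (hR : 0 < R) :
    ∫ x, ⟪R • (v (R • x) - c), fderiv ℝ g x a • c' - fderiv ℝ g x c' • a⟫_ℝ =
      R⁻¹ * ∫ y, ⟪curl v y, g (R⁻¹ • y) • cross c' a⟫_ℝ := by
  rw [integral_inner_curlPair_eq_integral_inner_curl_smul (contDiff_blowDown hv c R) hg hgc a c']
  have hcurl : ∀ x, curl (fun x => R • (v (R • x) - c)) x = (R * R) • curl v (R • x) := by
    intro x
    rw [curl_eq_curlCLM, fderiv_blowDown (hv.differentiable one_ne_zero) c R x, map_smul, ← curl_eq_curlCLM]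
  simp_rw [hcurl, inner_smul_left, RCLike.conj_to_real]
  rw [integral_const_mul]
  have h5 : ∫ x, ⟪curl v (R • x), g x • cross c' a⟫_ℝ = (R ^ 3)⁻¹ * ∫ y, ⟪curl v y, g (R⁻¹ • y) • cross c' a⟫_ℝ := by
    have h := integral_comp_inv_smul_E3 (fun y => ⟪curl v y, g (R⁻¹ • y) • cross c' a⟫_ℝ) (inv_nonneg.2 hR.le)
    simp only [inv_inv] at h
    have h' : (fun x => ⟪curl v (R • x), g (R⁻¹ • R • x) • cross c' a⟫_ℝ) = fun x => ⟪curl v (R • x), g x • cross c' a⟫_ℝ := by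
      funext x; rw [smul_smul, inv_mul_cancel₀ hR.ne', one_smul]
    rw [h'] at h
    rw [h, inv_pow]
  rw [h5]
  have hR0 : R ≠ 0 := hR.ne'
  field_simp

/-- **Blow-downs are solenoidal.** [folklore] -/
theorem isDivFree_blowDown (hv : Differentiable ℝ v) (hdiv : VectorCalculus.IsDivFree v) (c : E3) (R : ℝ) :
    VectorCalculus.IsDivFree fun x => R • (v (R • x) - c) := by
  intro x
  have h := hdiv (R • x)
  simp only [VectorCalculus.divergence] at h ⊢
  rw [fderiv_blowDown hv c R x, ContinuousLinearMap.toLinearMap_smul, map_smul, h, smul_zero]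

/-- The support of a pairing `⟪F, Φ⟫` is compact if that of `Φ` is. [folklore] -/
theorem hasCompactSupport_inner_right (F : E3 → E3) {Φ : E3 → E3} (hΦc : HasCompactSupport Φ) :
    HasCompactSupport fun x => ⟪F x, Φ x⟫_ℝ :=
  hΦc.mono fun x hx => by
    rw [mem_support] at hx ⊢
    intro h; exact hx (by rw [h, inner_zero_right])

/-- A pairing `⟪U, Φ⟫` of a locally integrable field with a continuous compactly supported one is integrable. [folklore] -/
theorem integrable_inner_of_locallyIntegrable {U Φ : E3 → E3} (hUl : LocallyIntegrable U volume)
    (hΦ : Continuous Φ) (hΦc : HasCompactSupport Φ) : Integrable (fun x => ⟪U x, Φ x⟫_ℝ) := by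
  have h := hUl.integrable_smul_left_of_hasCompactSupport hΦ.norm hΦc.norm
  refine h.mono (hUl.aestronglyMeasurable.inner hΦ.aestronglyMeasurable) (Eventually.of_forall fun x => ?_)
  rw [norm_smul, norm_norm, mul_comm]
  exact norm_inner_le_norm _ _

/-! ## The theorem -/

/-- **Blow-down limits of the residue are zero.**  Let `(v, μ)` be a K1b residue in a general frame — `v` smooth, solenoidal,
`‖v‖ ≡ M`, `Dv, D²v ∈ L²`, `M·√Z·√W > 0`, multiplier identity with finite measure `μ`, `c ≠ 0`, `‖c‖ = M`, `v − c ∈ L⁶` — whose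
excess energy grows at most linearly, `∫⁻_{B_ρ}‖v − c‖ₑ² ≤ C ρ` for `ρ ≥ 1`.  Let `Rₙ ≥ 1`, `Rₙ → ∞`, and suppose the blow-downs
`x ↦ Rₙ (v(Rₙ x) − c)` converge in `L²_loc` to a measurable `U`.  Then `U = 0` a.e.  (K1b itself is NOT proved here.) [folklore] -/
theorem blowDown_limit_ae_eq_zero (hv : ContDiff ℝ ∞ v) (hdiv : VectorCalculus.IsDivFree v) {M : ℝ}
    (hM : ∀ x, ‖v x‖ = M) (h1 : ∫⁻ x, ‖iteratedFDeriv ℝ 1 v x‖ₑ ^ 2 < ⊤) (h2 : ∫⁻ x, ‖iteratedFDeriv ℝ 2 v x‖ₑ ^ 2 < ⊤)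
    (hpos : 0 < M * Real.sqrt (Zen v) * Real.sqrt (Wpa v))
    (μ : Measure E3) [IsFiniteMeasure μ]
    (hμ : ∀ ψ : E3 → E3, ContDiff ℝ ∞ ψ → HasCompactSupport ψ → VectorCalculus.IsDivFree ψ →
      Jst v * J1 v ψ - kStar ^ 2 * M ^ 2 * (Wpa v * A1 v ψ + Zen v * C1 v ψ) = ∫ x, ⟪v x, ψ x⟫_ℝ ∂μ)
    (hc : c ≠ 0) (hcM : ‖c‖ = M) (hL6 : MemLp (fun x => v x - c) 6 volume)
    {Cg : ℝ} (hCg : 0 ≤ Cg) (hgrowth : ∀ ρ : ℝ, 1 ≤ ρ → ∫⁻ x in ball (0 : E3) ρ, ‖v x - c‖ₑ ^ 2 ≤ ENNReal.ofReal (Cg * ρ))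
    {Rn : ℕ → ℝ} (hRn1 : ∀ n, 1 ≤ Rn n) (hRn : Tendsto Rn atTop atTop)
    {U : E3 → E3} (hU : AEStronglyMeasurable U volume)
    (hconv : ∀ L : ℝ, 0 < L →
      Tendsto (fun n => ∫⁻ x in ball (0 : E3) L, ‖Rn n • (v (Rn n • x) - c) - U x‖ₑ ^ 2) atTop (𝓝 0)) :
    U =ᵐ[volume] 0 := by
  set F : ℕ → E3 → E3 := fun n x => Rn n • (v (Rn n • x) - c) with hF
  have hRn0 : ∀ n, 0 < Rn n := fun n => one_pos.trans_le (hRn1 n)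
  have hv1 : ContDiff ℝ 1 v := hv.of_le (by exact_mod_cast le_top)
  have hFc : ∀ n, Continuous (F n) := fun n => (contDiff_blowDown (n := 0) (hv.of_le (by exact_mod_cast le_top)) c (Rn n)).continuous
  have hFm : ∀ n, AEStronglyMeasurable (F n) volume := fun n => (hFc n).aestronglyMeasurable
  -- (1) growth of `U`
  have hA : ∀ L : ℝ, 1 ≤ L → ∫⁻ x in ball (0 : E3) L, ‖U x‖ₑ ^ 2 ≤ ENNReal.ofReal (Cg * L ^ (1 : ℝ)) := by
    intro L hL
    rw [Real.rpow_one]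
    refine lintegral_sq_le_of_L2loc hFm hU (fun n => ?_) (hconv L (one_pos.trans_le hL))
    show ∫⁻ x in ball (0 : E3) L, ‖Rn n • (v (Rn n • x) - c)‖ₑ ^ 2 ≤ ENNReal.ofReal (Cg * L)
    rw [lintegral_ball_blowDown_sq v c (hRn0 n) L]
    have hg := hgrowth (Rn n * L) (by nlinarith [hRn1 n])
    calc ENNReal.ofReal (Rn n)⁻¹ * ∫⁻ x in ball (0 : E3) (Rn n * L), ‖v x - c‖ₑ ^ 2
        ≤ ENNReal.ofReal (Rn n)⁻¹ * ENNReal.ofReal (Cg * (Rn n * L)) := mul_le_mul' le_rfl hg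
      _ = ENNReal.ofReal (Cg * L) := by
          rw [← ENNReal.ofReal_mul (inv_nonneg.2 (hRn0 n).le)]
          have e : (Rn n)⁻¹ * (Cg * (Rn n * L)) = Cg * L := by
            rw [← mul_assoc, ← mul_assoc, mul_comm (Rn n)⁻¹, mul_assoc Cg, inv_mul_cancel₀ (hRn0 n).ne', mul_one]
          rw [e]
  -- (2) local integrability of `U`
  have hfinU : ∀ R : ℝ, ∫⁻ x in ball (0 : E3) R, ‖U x‖ₑ ^ 2 < ⊤ := by
    intro R
    have h := hA (max R 1) (le_max_right _ _)
    exact lt_of_le_of_lt ((lintegral_mono_set (ball_subset_ball (le_max_left _ _))).trans h) ENNReal.ofReal_lt_top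
  have hUl : LocallyIntegrable U volume := locallyIntegrable_of_lintegral_ball_sq_lt_top hU hfinU
  -- pairings pass to the limit
  have hpair : ∀ Φ : E3 → E3, Continuous Φ → HasCompactSupport Φ →
      Tendsto (fun n => ∫ x, ⟪F n x, Φ x⟫_ℝ) atTop (𝓝 (∫ x, ⟪U x, Φ x⟫_ℝ)) := fun Φ hΦ hΦc =>
    tendsto_integral_inner_of_L2loc hFm hU hΦ hΦc
      (fun n => ((hFc n).inner hΦ).integrable_of_hasCompactSupport (hasCompactSupport_inner_right (F n) hΦc))
      (integrable_inner_of_locallyIntegrable hUl hΦ hΦc) hconv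
  have huniq : ∀ Φ : E3 → E3, Continuous Φ → HasCompactSupport Φ →
      Tendsto (fun n => ∫ x, ⟪F n x, Φ x⟫_ℝ) atTop (𝓝 0) → ∫ x, ⟪U x, Φ x⟫_ℝ = 0 := fun Φ hΦ hΦc h0 =>
    tendsto_nhds_unique (hpair Φ hΦ hΦc) h0
  -- (3) `U` is weakly solenoidal
  have hdivU : IsWeaklyDivFree U := by
    intro θ hθ
    have hθ1 : ContDiff ℝ 1 θ := hθ.contDiff.of_le (by exact_mod_cast le_top)
    have hgc : Continuous (gradient θ) := by
      unfold gradient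
      exact (InnerProductSpace.toDual ℝ E3).symm.continuous.comp (hθ1.continuous_fderiv one_ne_zero)
    have hgs : HasCompactSupport (gradient θ) :=
      (hθ.hasCompactSupport.fderiv (𝕜 := ℝ)).comp_left (g := (InnerProductSpace.toDual ℝ E3).symm) (map_zero _)
    refine huniq _ hgc hgs (tendsto_const_nhds.congr' (Eventually.of_forall fun n => ?_))
    exact (VectorCalculus.IsDivFree.isWeaklyDivFree_holds (isDivFree_blowDown (hv1.differentiable one_ne_zero) hdiv c (Rn n))
      (contDiff_blowDown hv1 c (Rn n)) θ hθ).symm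
  -- (4) `U` annihilates curl-type test fields (g6's vorticity law)
  have hcurlU : ∀ g : E3 → ℝ, FunctionSpaces.IsTestFunctionOn (⊤ : TopologicalSpace.Opens E3) g → ∀ a c' : E3,
      ∫ x, ⟪U x, fderiv ℝ g x a • c' - fderiv ℝ g x c' • a⟫_ℝ = 0 := by
    intro g hg a c'
    have hg1 : ContDiff ℝ 1 g := hg.contDiff.of_le (by exact_mod_cast le_top)
    have hDg : Continuous (fderiv ℝ g) := hg1.continuous_fderiv one_ne_zero
    have hΦc : Continuous fun x => fderiv ℝ g x a • c' - fderiv ℝ g x c' • a :=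
      ((hDg.clm_apply continuous_const).smul continuous_const).sub ((hDg.clm_apply continuous_const).smul continuous_const)
    have hΦs : HasCompactSupport fun x => fderiv ℝ g x a • c' - fderiv ℝ g x c' • a :=
      (hg.hasCompactSupport.fderiv (𝕜 := ℝ)).mono fun x hx => by
        rw [mem_support] at hx ⊢
        intro h0; exact hx (by rw [h0]; simp)
    have hB : ContDiff ℝ ∞ fun y => g y • cross c' a := hg.contDiff.smul contDiff_const
    have hBc : HasCompactSupport fun y => g y • cross c' a := hg.hasCompactSupport.smul_right
    have hT := (tendsto_blowDown_vorticity_zero_general hv hdiv hM h1 h2 hpos μ hμ hc hcM hL6 hB hBc).comp hRn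
    refine huniq _ hΦc hΦs (hT.congr fun n => ?_)
    show (Rn n)⁻¹ * ∫ y, ⟪curl v y, g ((Rn n)⁻¹ • y) • cross c' a⟫_ℝ = ∫ x, ⟪F n x, fderiv ℝ g x a • c' - fderiv ℝ g x c' • a⟫_ℝ
    exact (integral_inner_curlPair_blowDown hv1 c hg1 hg.hasCompactSupport a c' (hRn0 n)).symm
  -- (5) the components of `U` are weakly harmonic, (6) Liouville
  have hharm : ∀ ϑ : E3 → ℝ, FunctionSpaces.IsTestFunctionOn (⊤ : TopologicalSpace.Opens E3) ϑ → ∀ a : E3,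
      ∫ x, (Δ ϑ) x * ⟪U x, a⟫_ℝ = 0 := fun ϑ hϑ a =>
    integral_laplacian_mul_inner_eq_zero_of_curlPair hUl hdivU hcurlU hϑ a
  exact ae_eq_zero_of_weaklyHarmonic_of_growth hU hCg zero_le_one (by norm_num) hA hharm

end ExtremiserLiouville

end Summit.NavierStokesRegularity.NavierStokesRegularity.Theorems

end
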